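import Literature.NumberTheory.EllipticCurves.HeegnerPointsIdentityComponent
import Literature.NumberTheory.Automorphic.GaloisActionPlaces
import HarnessLib

/-!
# Route `GenusKolyvaginAtTwo`, crux U₂ `MinimalTwinBSDTwo` (stmt-BirchSwinnertonDyer-22985), LINE 23 «twin_swap», stub DIV′:
# THE COMPONENT ROAD — Gross–Zagier III (3.1) for the TRACE `P(1) = y_K`, and `2^s ∣ P(1)` from the component class of a generator

Seat `bsd-line-gk2-p2` g29 (PROVER 2/3, cell `bsd-f1-sign2`; LINE 23 holder), `--supports stmt-BirchSwinnertonDyer-22985` (helper; closes nothing).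
THEOREMS ONLY (no definition, no named fact, no `sorry`); standard axioms.  **BSD is NOT proved by this file; U₂ / DIV′ are NOT proved; no item is
closed.**  §1–§2 are UNCONDITIONAL infrastructure; §3–§4 are CONDITIONAL (D-0014) on the statement-only PUBLISHED fact
`Gross1991_heegnerPoint_sub_ratTorsion_mem_E0_imageFree` (Gross 1991 §6 / Gross–Zagier 1986 III (3.1): `y_n − t ∈ E⁰` at every place above `N`,
`t` rational torsion), displayed as a hypothesis.

WHY.  v2.5's upper half DIV′ («`#Ш(W_K)[2^∞]·4^{ord₂c+ord₂C(W)} ∣ 4^{M₀}`», product-form Kolyvagin–Jetchev bound for the rank-ONE member) contains, on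
`Ш(W_K)`-trivial odd-`c` frames, the divisibility «`2^{ord₂ C(W)} ∣ P(1)`»; gk2-p2 g28 identified it on the slice 𝒮 with the `n = 1` instance of the
route's crux 27467 `TamagawaDivisibilityAtTwo` (Jetchev 2008 Thm. 1.4 read at `p = 2` — beyond print).  The typer of the E⁰-fact recorded that its
transport to the trace was «kernel plumbing for the consumer, not done».  THIS FILE DOES THAT PLUMBING and reads off the elementary consequence:

* §1 `hasNonsingularReduction_placeIntModel_pointGalHom_iff` — **Galois transport of `E₀`**: for `σ ∈ Aut(L/ℚ)`, a place `w` of `L` and `P ∈ E(L)`,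
  `σP ∈ E₀(L)_{σw} ⟺ P ∈ E₀(L)_w` (the `E₀`-condition is a valuation condition on the coordinates and the RATIONAL partial derivatives,
  `hasNonsingularReduction_placeIntModel_iff`; `|σa|_{σw} = |a|_w`, `Literature.NumberTheory.Automorphic.HeightOneSpectrum.valuation_smul`);
  `hasNonsingularReduction_placeIntModel_sum` — `E₀(L)_w` is closed under finite sums (any `DecidableEq` instance).
* §2 `hasNonsingularReduction_derivedPoint_one_of_forall` — **the trace**: if an odd multiple of `y_1` lies in `E₀(K[1])_w` at EVERY place `w ∣ N`,
  then ONE odd multiple of `P(1) = Σ_{s∈S} s·y_1` lies in `E₀(K[1])_w` at every `w ∣ N` (transport at the places `s⁻¹w ∣ N`, product of the odd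
  multipliers, closure under sums).
* §3 `exists_odd_nsmul_derivedPoint_one_mem_E0_of_GZ31` — **GZ III (3.1) for `y_K`**: granted the E⁰-fact, on a curve WITHOUT rational `2`-torsion
  (`E(ℚ)[2] = 0`, so every rational torsion point has ODD order), at every place `w ∣ N` of `K[1]` some ODD multiple `m • P(1)` lies in `E₀`.
* §4 ★ `exists_two_pow_smul_eq_derivedPoint_one_of_componentOrder` — **THE COMPONENT ROAD**: if moreover `P(1) = a • g₁ + t₁` in `E(K[1])` with `g₁`
  ANY point, `t₁` of finite ODD order, and at ONE place `w₀ ∣ N` the component class of `g₁` has `2`-order `≥ 2^s` («`k • g₁ ∈ E₀(K[1])_{w₀} ⟹ 2^s ∣ k`»),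
  then **`2^s ∣ P(1)` in `E(K[1])`** (`∃ Q, 2^s • Q = P(1)`).  On the rank-one `2`-Selmer-minimal frames of LINE 23 (`g₁` = the image of a generator
  of `W(ℚ)/tors`, `t₁` odd torsion — gk2-p4 g26's rational Heegner point) with ONE bad prime `q₀` at which that generator spans the `2`-part of
  `Φ_{q₀}(ℚ_{q₀})` of order `2^{ord₂ C(W)}`, this is «`2^{ord₂ C(W)} ∣ P(1)`» = 27467∣_{n=1} on that cell — from GZ III (3.1) (PRINT) instead of Jetchev-at-2.
  MAX-type by nature (one place at a time), like Jetchev's `m_max`: it cannot produce the product form when two bad primes carry `2`-parts.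

References: [GrossLMS1991] §6 proof of Prop. 6.2 (1) (p. 245), §4 (4.1); [GrossZagier1986Heegner] III (3.1); [SilvermanAEC2009] VII §2 Prop. 2.1;
[CasselsFrohlichANT1967] Ch. VII §1.1 (`|σa|_{σw} = |a|_w`); [Jetchev2008] Thm. 1.4 / Conj. 1.3 (comparison only).
-/

set_option autoImplicit false
set_option linter.dupNamespace false -- `Summit.<P>.<Sub>` repeats `BirchSwinnertonDyer` (D-0017)

noncomputable section

open NumberField WeierstrassCurve IsDedekindDomain
open Literature.NumberTheory.EllipticCurves Literature.NumberTheory.EllipticCurves.ModularForms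
open Literature.NumberTheory.Automorphic

namespace Summit.BirchSwinnertonDyer.BirchSwinnertonDyer.Theorems.GenusExact.TwinSwap.ComponentRoad

/-! ## §1 Galois transport of `E₀` at a place; closure under sums -/

section Transport

variable (W : WeierstrassCurve ℚ) (L : Type) [Field L] [NumberField L]

/-- The partial derivative `Φ_x` of the RATIONAL equation commutes with `σ ∈ Aut(L/ℚ)`. [folklore] -/
theorem algEquiv_evalEval_polynomialX (σ : L ≃ₐ[ℚ] L) (x y : L) :
    σ ((W.baseChange L).toAffine.polynomialX.evalEval x y) =
      (W.baseChange L).toAffine.polynomialX.evalEval (σ x) (σ y) := by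
  simp only [Affine.evalEval_polynomialX, map_sub, map_mul, map_add, map_pow, map_ofNat]
  simp [WeierstrassCurve.baseChange]

/-- The partial derivative `Φ_y` of the RATIONAL equation commutes with `σ ∈ Aut(L/ℚ)`. [folklore] -/
theorem algEquiv_evalEval_polynomialY (σ : L ≃ₐ[ℚ] L) (x y : L) :
    σ ((W.baseChange L).toAffine.polynomialY.evalEval x y) =
      (W.baseChange L).toAffine.polynomialY.evalEval (σ x) (σ y) := by
  simp only [Affine.evalEval_polynomialY, map_mul, map_add, map_ofNat]
  simp [WeierstrassCurve.baseChange]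

/-- **Valuation form of the transport**: the coordinate `E₀`-condition at `σ • w` for `(σx, σy)` is the one at `w` for `(x, y)` (`|σa|_{σw} = |a|_w`).
[cite: CasselsFrohlichANT1967, Ch. VII §1.1] -/
theorem hasNonsingularReductionAtK_smul_iff (σ : L ≃ₐ[ℚ] L) (w : HeightOneSpectrum (𝓞 L)) (x y : L) :
    W.HasNonsingularReductionAtK L (σ • w) (σ x) (σ y) ↔ W.HasNonsingularReductionAtK L w x y := by
  unfold WeierstrassCurve.HasNonsingularReductionAtK
  rw [← algEquiv_evalEval_polynomialX W L σ x y, ← algEquiv_evalEval_polynomialY W L σ x y]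
  have hv : ∀ z : L, (σ • w).valuation L (σ z) = w.valuation L z := fun z ↦
    HeightOneSpectrum.valuation_smul L σ w z
  rw [hv, hv, hv]

/-- **GALOIS TRANSPORT OF `E₀`**: for `σ ∈ Aut(L/ℚ)`, a finite place `w` of `L` and `P ∈ E(L)` (`W/ℚ` integral, read on the model `W` at the place:
`placeIntModel`), `σP` has nonsingular reduction at `σ • w` iff `P` has nonsingular reduction at `w`.  [cite: SilvermanAEC2009, VII §2 Prop. 2.1]
[cite: CasselsFrohlichANT1967, Ch. VII §1.1] -/
theorem hasNonsingularReduction_placeIntModel_pointGalHom_iff [W.IsIntegral ℤ] [DecidableEq L] (σ : L ≃ₐ[ℚ] L)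
    (w : HeightOneSpectrum (𝓞 L)) (P : (W.baseChange L).toAffine.Point) :
    WeierstrassCurve.HasNonsingularReduction (K := L) (placeIntModel W L (σ • w)) (pointGalHom W L σ P) ↔
      WeierstrassCurve.HasNonsingularReduction (K := L) (placeIntModel W L w) P := by
  rcases P with _ | ⟨x, y, hxy⟩
  · exact iff_of_true (WeierstrassCurve.hasNonsingularReduction_zero (K := L) (W := placeIntModel W L (σ • w)))
      (WeierstrassCurve.hasNonsingularReduction_zero (K := L) (W := placeIntModel W L w))
  · have h' : (W.baseChange L).toAffine.Nonsingular (σ x) (σ y) :=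
      (Affine.baseChange_nonsingular (W := W) (f := (σ : L →ₐ[ℚ] L)) (σ : L →ₐ[ℚ] L).injective x y).mpr hxy
    have hmap : pointGalHom W L σ (.some x y hxy) = .some (σ x) (σ y) h' := rfl
    have key := ((hasNonsingularReduction_placeIntModel_iff (W := W) (K := L) (σ • w) h').trans
      (hasNonsingularReductionAtK_smul_iff W L σ w x y)).trans (hasNonsingularReduction_placeIntModel_iff (W := W) (K := L) w hxy).symm
    rw [hmap]
    exact key

/-- `E₀(L)_w` is closed under addition, for an ARBITRARY `DecidableEq` instance on `L` (the tree's `HasNonsingularReduction.add` is stated with the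
classical one; the two group laws agree because `DecidableEq L` is a subsingleton — same device as
`Gross1991_heegnerPoint_sub_ratTorsion_mem_E0.hasNonsingularReduction_nsmul`). [cite: SilvermanAEC2009, VII §2 Prop. 2.1] -/
theorem hasNonsingularReduction_placeIntModel_add [W.IsIntegral ℤ] [DecidableEq L] (w : HeightOneSpectrum (𝓞 L))
    {P Q : (W.baseChange L).toAffine.Point}
    (hP : WeierstrassCurve.HasNonsingularReduction (K := L) (placeIntModel W L w) P)
    (hQ : WeierstrassCurve.HasNonsingularReduction (K := L) (placeIntModel W L w) Q) :
    WeierstrassCurve.HasNonsingularReduction (K := L) (placeIntModel W L w) (P + Q) := by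
  obtain rfl : ‹DecidableEq L› = fun a b ↦ Classical.propDecidable (a = b) := Subsingleton.elim _ _
  exact WeierstrassCurve.HasNonsingularReduction.add (valuation_integers_valuationSubring _) hP hQ

/-- `E₀(L)_w` is closed under finite sums (arbitrary `DecidableEq` instance). [cite: SilvermanAEC2009, VII §2 Prop. 2.1] -/
theorem hasNonsingularReduction_placeIntModel_sum [W.IsIntegral ℤ] [DecidableEq L] (w : HeightOneSpectrum (𝓞 L))
    {ι' : Type*} (S : Finset ι') (f : ι' → (W.baseChange L).toAffine.Point)
    (h : ∀ i ∈ S, WeierstrassCurve.HasNonsingularReduction (K := L) (placeIntModel W L w) (f i)) :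
    WeierstrassCurve.HasNonsingularReduction (K := L) (placeIntModel W L w) (∑ i ∈ S, f i) := by
  classical
  induction S using Finset.induction_on with
  | empty => rw [Finset.sum_empty]; exact WeierstrassCurve.hasNonsingularReduction_zero (K := L) (W := placeIntModel W L w)
  | insert a S ha ih =>
    rw [Finset.sum_insert ha]
    exact hasNonsingularReduction_placeIntModel_add W L w (h a (Finset.mem_insert_self a S))
      (ih fun i hi ↦ h i (Finset.mem_insert_of_mem hi))

/-- A multiple of a point of `E₀(L)_w` is in `E₀(L)_w` (arbitrary `DecidableEq`; the fact-file's lemma, re-exported for the reader).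
[cite: SilvermanAEC2009, VII §2 Prop. 2.1] -/
theorem hasNonsingularReduction_placeIntModel_nsmul [W.IsIntegral ℤ] [DecidableEq L] (w : HeightOneSpectrum (𝓞 L))
    {P : (W.baseChange L).toAffine.Point} (hP : WeierstrassCurve.HasNonsingularReduction (K := L) (placeIntModel W L w) P) (m : ℕ) :
    WeierstrassCurve.HasNonsingularReduction (K := L) (placeIntModel W L w) (m • P) :=
  Gross1991_heegnerPoint_sub_ratTorsion_mem_E0.hasNonsingularReduction_nsmul (valuation_integers_valuationSubring _) hP m

/-- The places above `N` are permuted by `Aut(L/ℚ)`: `N ∈ 𝔭_{σ • w} ⟺ N ∈ 𝔭_w`. [folklore] -/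
theorem natCast_mem_smul_asIdeal_iff (σ : L ≃ₐ[ℚ] L) (w : HeightOneSpectrum (𝓞 L)) (N : ℕ) :
    ((N : ℕ) : 𝓞 L) ∈ (σ • w).asIdeal ↔ ((N : ℕ) : 𝓞 L) ∈ w.asIdeal := by
  have h := HeightOneSpectrum.smul_mem_smul_asIdeal_iff σ w ((N : ℕ) : 𝓞 L)
  rwa [show σ • ((N : ℕ) : 𝓞 L) = ((N : ℕ) : 𝓞 L) from map_natCast (MulSemiringAction.toRingHom _ (𝓞 L) σ) N] at h

end Transport

/-! ## §2 The trace `P(1) = Σ_{s ∈ S} s · y_1` -/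

section Trace

variable {N : ℕ} [NeZero N] {W : WeierstrassCurve ℚ} [W.IsElliptic] [W.IsGloballyMinimal]
  {K : Type} [Field K] [NumberField K] {Dt : ModularParametrizationData W N} {β : ℤ} {ι : K →+* ℂ}

omit [W.IsElliptic] in
/-- **An odd multiple of the trace `P(1)` lies in `E₀` at every place above `N`, if odd multiples of `y_1` do.**  For a level-`1` Kolyvagin–Heegner
datum `d₁` (`P(1) = Σ_{s∈S} s·y_1`, `KolyvaginHeegnerData.derivedPoint_one`): if for every place `w ∣ N` of `K[1]` some ODD `m_w` has
`m_w • y_1 ∈ E₀(K[1])_w`, then for every place `w ∣ N` some ODD `m` has `m • P(1) ∈ E₀(K[1])_w` — take `m = ∏_{s∈S} m_{s⁻¹w}` and transport each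
`s·y_1` from `s⁻¹ w` (§1). [cite: GrossLMS1991, §4 (4.1) (P_1 = Tr y_1)] [cite: SilvermanAEC2009, VII §2 Prop. 2.1] -/
theorem hasNonsingularReduction_derivedPoint_one_of_forall [NumberField (ringClassField K ι 1)]
    (d₁ : KolyvaginHeegnerData Dt β ι 1)
    (h : ∀ w : HeightOneSpectrum (𝓞 (ringClassField K ι 1)), ((N : ℕ) : 𝓞 (ringClassField K ι 1)) ∈ w.asIdeal →
      ∃ m : ℕ, Odd m ∧ WeierstrassCurve.HasNonsingularReduction (K := ringClassField K ι 1)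
        (placeIntModel W (ringClassField K ι 1) w) (m • d₁.y))
    (w : HeightOneSpectrum (𝓞 (ringClassField K ι 1))) (hw : ((N : ℕ) : 𝓞 (ringClassField K ι 1)) ∈ w.asIdeal) :
    ∃ m : ℕ, Odd m ∧ WeierstrassCurve.HasNonsingularReduction (K := ringClassField K ι 1)
      (placeIntModel W (ringClassField K ι 1) w) (m • d₁.derivedPoint) := by
  -- an odd multiplier at each conjugate place `s⁻¹ • w ∣ N`
  have hconj : ∀ s : ringClassField K ι 1 ≃ₐ[ℚ] ringClassField K ι 1, ∃ m : ℕ, Odd m ∧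
      WeierstrassCurve.HasNonsingularReduction (K := ringClassField K ι 1)
        (placeIntModel W (ringClassField K ι 1) (s⁻¹ • w)) (m • d₁.y) := fun s ↦
    h (s⁻¹ • w) ((natCast_mem_smul_asIdeal_iff (ringClassField K ι 1) s⁻¹ w N).mpr hw)
  choose mf hmf_odd hmf using hconj
  refine ⟨∏ s ∈ d₁.S, mf s, Finset.prod_induction mf Odd (fun a b ha hb ↦ ha.mul hb) odd_one (fun s _ ↦ hmf_odd s), ?_⟩
  rw [KolyvaginHeegnerData.derivedPoint_one, Finset.smul_sum]
  refine hasNonsingularReduction_placeIntModel_sum W (ringClassField K ι 1) w d₁.S _ fun s hs ↦ ?_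
  -- `(∏ m) • (s · y) = s · ((∏ m) • y)`, and `(∏ m) • y` is a multiple of `m_s • y ∈ E₀(K[1])_{s⁻¹ w}`
  rw [← map_nsmul]
  obtain ⟨k, hk⟩ := Finset.dvd_prod_of_mem mf hs
  have hy : WeierstrassCurve.HasNonsingularReduction (K := ringClassField K ι 1)
      (placeIntModel W (ringClassField K ι 1) (s⁻¹ • w)) ((∏ s ∈ d₁.S, mf s) • d₁.y) := by
    rw [hk, mul_comm, mul_smul]
    exact hasNonsingularReduction_placeIntModel_nsmul W (ringClassField K ι 1) (s⁻¹ • w) (hmf s) k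
  have key := (hasNonsingularReduction_placeIntModel_pointGalHom_iff W (ringClassField K ι 1) s (s⁻¹ • w)
    ((∏ s ∈ d₁.S, mf s) • d₁.y)).mpr hy
  rwa [smul_inv_smul] at key

end Trace

/-! ## §3 Gross–Zagier III (3.1) for the trace `y_K = P(1)` on a curve without rational `2`-torsion -/

section GZ31

variable {N : ℕ} [NeZero N] {W : WeierstrassCurve ℚ} [W.IsElliptic] [W.IsGloballyMinimal]
  {K : Type} [Field K] [NumberField K] {Dt : ModularParametrizationData W N} {β : ℤ} {ι : K →+* ℂ}

omit [W.IsElliptic] [W.IsGloballyMinimal] [NeZero N] in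
/-- On a curve with `E(ℚ)[2] = 0` every rational torsion point has ODD order. [folklore] -/
theorem odd_addOrderOf_of_noRationalTwoTorsion (hT2 : ∀ P : W.toAffine.Point, 2 • P = 0 → P = 0)
    {t : W.toAffine.Point} (ht : IsOfFinAddOrder t) : Odd (addOrderOf t) := by
  by_contra hodd
  rw [Nat.not_odd_iff_even] at hodd
  obtain ⟨k, hk⟩ := hodd
  have hpos : 0 < addOrderOf t := ht.addOrderOf_pos
  have hkt : k • t = 0 := hT2 (k • t) (by rw [smul_smul, two_mul, ← hk]; exact addOrderOf_nsmul_eq_zero t)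
  have hdvd : addOrderOf t ∣ k := addOrderOf_dvd_of_nsmul_eq_zero hkt
  have hle : addOrderOf t ≤ k := Nat.le_of_dvd (by omega) hdvd
  omega

omit [W.IsElliptic] [W.IsGloballyMinimal] in
/-- `E(ℚ) → E(L)` commutes with multiples (Mathlib's `Affine.Point.map`). [folklore] -/
theorem pointToBaseChange_nsmul (L : Type) [Field L] [NumberField L] [DecidableEq L] (m : ℕ)
    (t : W.toAffine.Point) : W.pointToBaseChange L (m • t) = m • W.pointToBaseChange L t := by
  rw [pointToBaseChange_eq_map, pointToBaseChange_eq_map]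
  exact map_nsmul (Affine.Point.map (W' := W) (F := ℚ) (Algebra.ofId ℚ L)) m t

/-- **GZ III (3.1) for `y_1`, odd form**: granted the E⁰-fact (image-free scope, applied at `n = 1` with the odd prime `3`: no Kolyvagin prime is
involved), on a curve with `E(ℚ)[2] = 0`, at every place `w ∣ N` of `K[1]` some ODD multiple of `y_1` lies in `E₀(K[1])_w` (the order of Gross's
rational torsion translate). [cite: GrossLMS1991, §6, proof of Prop. 6.2 (1), p. 245] [cite: GrossZagier1986Heegner, III (3.1)] -/
theorem exists_odd_nsmul_y_mem_E0_of_GZ31 (hGZ31 : Gross1991_heegnerPoint_sub_ratTorsion_mem_E0_imageFree)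
    (hT2 : ∀ P : W.toAffine.Point, 2 • P = 0 → P = 0)
    (hK : IsImaginaryQuadratic K) (hD : NumberField.discr K ≠ -3 ∧ NumberField.discr K ≠ -4)
    (hH : SatisfiesHeegnerHypothesis N K) [NumberField (ringClassField K ι 1)] (d₁ : KolyvaginHeegnerData Dt β ι 1)
    (w : HeightOneSpectrum (𝓞 (ringClassField K ι 1))) (hw : ((N : ℕ) : 𝓞 (ringClassField K ι 1)) ∈ w.asIdeal) :
    ∃ m : ℕ, Odd m ∧ WeierstrassCurve.HasNonsingularReduction (K := ringClassField K ι 1)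
      (placeIntModel W (ringClassField K ι 1) w) (m • d₁.y) := by
  obtain ⟨t, ht, hmem⟩ := hGZ31 Dt hK hD hH ι Nat.prime_three (by norm_num) (n := 1) squarefree_one
    (fun ℓ hℓ ↦ by simp at hℓ) d₁ w hw
  refine ⟨addOrderOf t, odd_addOrderOf_of_noRationalTwoTorsion hT2 ht, ?_⟩
  have heq : addOrderOf t • (d₁.y - W.pointToBaseChange (ringClassField K ι 1) t) = addOrderOf t • d₁.y := by
    rw [nsmul_sub, ← pointToBaseChange_nsmul, addOrderOf_nsmul_eq_zero,
      show W.pointToBaseChange (ringClassField K ι 1) 0 = 0 from rfl, sub_zero]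
  exact heq ▸ hasNonsingularReduction_placeIntModel_nsmul W (ringClassField K ι 1) w hmem (addOrderOf t)

/-- **GZ III (3.1) FOR THE TRACE `y_K = P(1)`**: granted the E⁰-fact, on a curve with `E(ℚ)[2] = 0`, for `K` imaginary quadratic Heegner with
`d_K ∉ {−3, −4}` and a level-`1` Kolyvagin–Heegner datum, at every place `w ∣ N` of `K[1]` some ODD multiple `m • P(1)` lies in `E₀(K[1])_w`.
CONDITIONAL on the displayed statement-only fact. [cite: GrossLMS1991, §6, proof of Prop. 6.2 (1), p. 245; §4 (4.1)]
[cite: GrossZagier1986Heegner, III (3.1)] -/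
theorem exists_odd_nsmul_derivedPoint_one_mem_E0_of_GZ31 (hGZ31 : Gross1991_heegnerPoint_sub_ratTorsion_mem_E0_imageFree)
    (hT2 : ∀ P : W.toAffine.Point, 2 • P = 0 → P = 0)
    (hK : IsImaginaryQuadratic K) (hD : NumberField.discr K ≠ -3 ∧ NumberField.discr K ≠ -4)
    (hH : SatisfiesHeegnerHypothesis N K) [NumberField (ringClassField K ι 1)] (d₁ : KolyvaginHeegnerData Dt β ι 1)
    (w : HeightOneSpectrum (𝓞 (ringClassField K ι 1))) (hw : ((N : ℕ) : 𝓞 (ringClassField K ι 1)) ∈ w.asIdeal) :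
    ∃ m : ℕ, Odd m ∧ WeierstrassCurve.HasNonsingularReduction (K := ringClassField K ι 1)
      (placeIntModel W (ringClassField K ι 1) w) (m • d₁.derivedPoint) :=
  hasNonsingularReduction_derivedPoint_one_of_forall d₁
    (fun w' hw' ↦ exists_odd_nsmul_y_mem_E0_of_GZ31 hGZ31 hT2 hK hD hH d₁ w' hw') w hw

end GZ31

/-! ## §4 The component road: `2^s ∣ P(1)` from the component class of a generator -/

section Road

variable {N : ℕ} [NeZero N] {W : WeierstrassCurve ℚ} [W.IsElliptic] [W.IsGloballyMinimal]
  {K : Type} [Field K] [NumberField K] {Dt : ModularParametrizationData W N} {β : ℤ} {ι : K →+* ℂ}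

/-- Pure algebra: a point of finite ODD order is `2^s`-divisible within its own multiples (Bézout). [folklore] -/
theorem exists_two_pow_zsmul_eq_of_odd_addOrderOf {A : Type*} [AddCommGroup A] {t : A} (hodd : Odd (addOrderOf t)) (s : ℕ) :
    ∃ c : ℤ, ((2 ^ s : ℕ) : ℤ) • (c • t) = t := by
  have hcop : Nat.Coprime (2 ^ s) (addOrderOf t) := Nat.Coprime.pow_left s (Nat.coprime_two_left.mpr hodd)
  obtain ⟨u, v, huv⟩ := Nat.isCoprime_iff_coprime.mpr hcop
  refine ⟨u, ?_⟩
  have ho : (addOrderOf t : ℤ) • t = 0 := by rw [natCast_zsmul]; exact addOrderOf_nsmul_eq_zero t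
  calc ((2 ^ s : ℕ) : ℤ) • (u • t) = (u * ((2 ^ s : ℕ) : ℤ) + v * (addOrderOf t : ℤ)) • t := by
        rw [add_smul, mul_smul v, ho, smul_zero, add_zero, smul_smul, mul_comm]
    _ = t := by rw [huv, one_smul]

/-- Pure arithmetic: `2^s ∣ m·a` with `m` odd forces `2^s ∣ a`. [folklore] -/
theorem two_pow_dvd_of_dvd_odd_mul {m : ℕ} (hm : Odd m) {s : ℕ} {a : ℤ} (h : ((2 ^ s : ℕ) : ℤ) ∣ (m : ℤ) * a) :
    ((2 ^ s : ℕ) : ℤ) ∣ a := by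
  have hcop : Nat.Coprime (2 ^ s) m := Nat.Coprime.pow_left s (Nat.coprime_two_left.mpr hm)
  exact (Nat.isCoprime_iff_coprime.mpr hcop).dvd_of_dvd_mul_left h

/-- ★ **THE COMPONENT ROAD: `2^s ∣ P(1)` FROM THE COMPONENT CLASS OF A GENERATOR.**  `W/ℚ` globally minimal with `E(ℚ)[2] = 0`; `K` imaginary
quadratic, Heegner for `N`, `d_K ∉ {−3, −4}`; a level-`1` Kolyvagin–Heegner datum `d₁`; a decomposition `P(1) = a • g₁ + t₁` in `E(K[1])` with `t₁` of
finite ODD order (on LINE 23's rank-one frames: `g₁` the image of a generator of `W(ℚ)/tors`, gk2-p4 g26's rational Heegner point); ONE place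
`w₀ ∣ N` of `K[1]` at which the component class of `g₁` has `2`-order at least `2^s`: «`k • g₁ ∈ E₀(K[1])_{w₀} ⟹ 2^s ∣ k`».  Granted GZ III (3.1)
(`Gross1991_heegnerPoint_sub_ratTorsion_mem_E0_imageFree`, displayed): **`∃ Q ∈ E(K[1]), 2^s • Q = P(1)`**.  Proof: §3 gives an odd `m` with
`m • P(1) ∈ E₀(K[1])_{w₀}`; with `o = ord t₁` (odd), `(o·m) • P(1) = (o·m·a) • g₁ ∈ E₀`, so `2^s ∣ o·m·a`, so `2^s ∣ a`; and `t₁` is `2^s`-divisible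
(odd order).  READING (census, not progress on BSD): with `s = ord₂ C(W)` this is the divisibility «`2^{ord₂ C(W)} ∣ P(1)`» that v2.5's DIV′ contains
on `Ш(W_K)`-trivial odd-`c` frames and that gk2-p2 g28 drew from crux 27467 (Jetchev at `2`) on the slice 𝒮 — here from PRINT (GZ III (3.1)), on the
cell where one bad place sees the full `2`-part through the generator.  CONDITIONAL on the displayed fact; BSD is NOT proved; nothing is closed.
[cite: GrossLMS1991, §6, proof of Prop. 6.2 (1), p. 245; §4 (4.1)] [cite: GrossZagier1986Heegner, III (3.1)] [cite: SilvermanAEC2009, VII §2 Prop. 2.1] -/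
theorem exists_two_pow_smul_eq_derivedPoint_one_of_componentOrder
    (hGZ31 : Gross1991_heegnerPoint_sub_ratTorsion_mem_E0_imageFree)
    (hT2 : ∀ P : W.toAffine.Point, 2 • P = 0 → P = 0)
    (hK : IsImaginaryQuadratic K) (hD : NumberField.discr K ≠ -3 ∧ NumberField.discr K ≠ -4)
    (hH : SatisfiesHeegnerHypothesis N K) [NumberField (ringClassField K ι 1)] (d₁ : KolyvaginHeegnerData Dt β ι 1)
    (g₁ t₁ : (W.baseChange (ringClassField K ι 1)).toAffine.Point) (a : ℤ) (hdec : d₁.derivedPoint = a • g₁ + t₁)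
    (ht₁ : Odd (addOrderOf t₁))
    (w₀ : HeightOneSpectrum (𝓞 (ringClassField K ι 1))) (hw₀ : ((N : ℕ) : 𝓞 (ringClassField K ι 1)) ∈ w₀.asIdeal) (s : ℕ)
    (hs : ∀ k : ℤ, WeierstrassCurve.HasNonsingularReduction (K := ringClassField K ι 1)
      (placeIntModel W (ringClassField K ι 1) w₀) (k • g₁) → ((2 ^ s : ℕ) : ℤ) ∣ k) :
    ∃ Q : (W.baseChange (ringClassField K ι 1)).toAffine.Point, ((2 ^ s : ℕ) : ℤ) • Q = d₁.derivedPoint := by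
  obtain ⟨m, hm, hE0⟩ := exists_odd_nsmul_derivedPoint_one_mem_E0_of_GZ31 hGZ31 hT2 hK hD hH d₁ w₀ hw₀
  -- `(o·m) • P(1) = (o·m·a) • g₁ ∈ E₀(K[1])_{w₀}`
  have hom : WeierstrassCurve.HasNonsingularReduction (K := ringClassField K ι 1)
      (placeIntModel W (ringClassField K ι 1) w₀) (addOrderOf t₁ • (m • d₁.derivedPoint)) :=
    hasNonsingularReduction_placeIntModel_nsmul W (ringClassField K ι 1) w₀ hE0 (addOrderOf t₁)
  have hcalc : addOrderOf t₁ • (m • d₁.derivedPoint) = (((addOrderOf t₁ * m : ℕ) : ℤ) * a) • g₁ := by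
    have ho : (addOrderOf t₁ : ℤ) • t₁ = 0 := by rw [natCast_zsmul]; exact addOrderOf_nsmul_eq_zero t₁
    rw [hdec, ← natCast_zsmul, ← natCast_zsmul, smul_add, smul_add, smul_smul, smul_smul, smul_smul,
      mul_comm (addOrderOf t₁ : ℤ) (m : ℤ), mul_smul (m : ℤ) (addOrderOf t₁ : ℤ) t₁, ho, smul_zero, add_zero]
    congr 1
    push_cast
    ring
  rw [hcalc] at hom
  -- `2^s ∣ o·m·a`, and `o·m` is odd
  have hdvd : ((2 ^ s : ℕ) : ℤ) ∣ a := two_pow_dvd_of_dvd_odd_mul (ht₁.mul hm) (hs _ hom)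
  obtain ⟨b, hb⟩ := hdvd
  obtain ⟨c, hc⟩ := exists_two_pow_zsmul_eq_of_odd_addOrderOf ht₁ s
  refine ⟨b • g₁ + c • t₁, ?_⟩
  rw [smul_add, hc, smul_smul, ← hb, ← hdec]

end Road



end Summit.BirchSwinnertonDyer.BirchSwinnertonDyer.Theorems.GenusExact.TwinSwap.ComponentRoad

end
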